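import Summits.BirchSwinnertonDyer.BirchSwinnertonDyer.Theorems.GenusKolyvaginAtTwoTorsionCellD0PairTwistSymbols
import Mathlib.LinearAlgebra.Dual.Lemmas
import Mathlib.FieldTheory.Finiteness
import HarnessLib

/-!
# D0≤2, parity of the genus twist, VI: bit identities for the pairing of the two frames

Crux R″ `RankOneTwoTorsionResidualAtTwo` (stmt-27478), LINE 49 «full_vertex», stub D0≤2
`FullTorsionGenusSelmerLawUpToTwoAtTwo`, slice `#Q₀ = 2`, the `2`-PARITY HALF of `#Sel⁽²⁾(E₀^{(−p₀q₁q₂)}) = 8`.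
Elementary identities used to identify the Hilbert-symbol Tate form `∑_v Q_v` on the relaxed group
(`…ParityLocal.sum_descentFormBits_out_eq_zero`) with the pairing `f(n)` of the standard metabolic space `N* × N`,
`N = (ℤ/2)⁷`, between the coordinates `n` (E's local conditions at `∞, p, q₁, q₂`) and `f` (those of `E^{(d)}`):
`toDual_basisFun_apply` (`(Pi.basisFun).toDual c n = ∑ cᵢ nᵢ`), `bitsum_pair`, `bitsum_infty`, `kappa_add_kappa'`,
`rel_iff`, `vec7_eq_zero_iff`, and `finrank_eq_of_natCard_zmod_two` (`#V = 2^k ⇒ dim V = k`).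

Everything is proved; no LINE 49 statement is restated; BSD is not advanced by this file alone.

## References

* [KlagsbrunMazurRubin2013] Z. Klagsbrun, B. Mazur, K. Rubin, Ann. of Math. 178 (2013), Def. 3.3, Thm. 3.9.
-/

noncomputable section

open scoped Classical

namespace Summit.BirchSwinnertonDyer.BirchSwinnertonDyer.Theorems.GenusKolyvaginAtTwo.TorsionCellD0

open Literature.NumberTheory.EllipticCurves.TwoDescentLocal
open Literature.NumberTheory.EllipticCurves.KramerTwoDescent

/-- A finite `ℤ/2`-vector space of cardinality `2^k` has dimension `k`. [folklore] -/
theorem finrank_eq_of_natCard_zmod_two {V : Type*} [AddCommGroup V] [Module (ZMod 2) V] [Module.Finite (ZMod 2) V]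
    {k : ℕ} (h : Nat.card V = 2 ^ k) : Module.finrank (ZMod 2) V = k := by
  rw [Module.natCard_eq_pow_finrank (K := ZMod 2), Nat.card_zmod] at h
  exact Nat.pow_right_injective le_rfl h

/-- `(Pi.basisFun).toDual c n = ∑ᵢ cᵢ nᵢ`: the duality `N* × N → ℤ/2` of the split space in coordinates.
[cite: KlagsbrunMazurRubin2013, Def. 2.1] -/
theorem toDual_basisFun_apply {R : Type*} [CommRing R] {ι : Type*} [Fintype ι] [DecidableEq ι] (c n : ι → R) :
    (Pi.basisFun R ι).toDual c n = ∑ i, c i * n i := by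
  conv_lhs => rw [← (Pi.basisFun R ι).sum_repr n]
  rw [map_sum]
  refine Finset.sum_congr rfl fun i _ => ?_
  rw [map_smul, Module.Basis.toDual_apply_left, Pi.basisFun_repr, Pi.basisFun_repr, smul_eq_mul, mul_comm]

/-- The local identity at a twisting prime: pairing E's coordinates `(β, α)` (parities) against `E^{(d)}`'s
(`I₀*` relations) gives the Hilbert-symbol Tate form `αβ + βρ + ασ + αδ₂ + βδ₁` when `κ + κ' = 1`. [folklore] -/
theorem bitsum_pair (α β ρ σ κ κ' δ₁ δ₂ : ZMod 2) (hk : κ + κ' = 1) :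
    (ρ + κ * α + δ₁ * β) * β + (σ + δ₂ * α + κ' * β) * α = α * β + β * ρ + α * σ + α * δ₂ + β * δ₁ := by
  have hk' : κ' = 1 + κ := by revert hk κ κ'; decide
  subst hk'
  revert α β ρ σ κ δ₁ δ₂
  decide

/-- The local identity at `∞`: `s_a (s_a + s_b) = s_a s_b + s_a · 1 + s_b · 0`. [folklore] -/
theorem bitsum_infty (s t : ZMod 2) : (s + t) * s = s * t + s * 1 + t * 0 := by
  revert s t; decide

/-- `κ + κ' = 1`: `qr_q(d e₂ − d e₁) + qr_q(d e₁ − d e₂) = qr_q(−1) = 1` at `q ≡ 3 (mod 4)`. [folklore] -/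
theorem kappa_add_kappa' {q : ℕ} [Fact q.Prime] (hq4 : q % 4 = 3) {d e₁ e₂ : ℚ} (hne : e₁ ≠ e₂) :
    (qrBit q d + qrBit q (e₂ - e₁)) + (qrBit q d + qrBit q (e₁ - e₂)) = 1 := by
  have h21 : e₂ - e₁ ≠ 0 := sub_ne_zero.mpr hne.symm
  rw [show e₁ - e₂ = (-1) * (e₂ - e₁) by ring, qrBit_mul q (by norm_num) h21, qrBit_neg_one_eq_one_of_emod_four hq4]
  generalize qrBit q d = x; generalize qrBit q (e₂ - e₁) = y
  revert x y; decide

/-- Two rationals have the same sign iff their sign bits sum to `0`. [folklore] -/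
theorem signBit_add_signBit_eq_zero_iff (a b : ℚ) : signBit a + signBit b = 0 ↔ signBit a = signBit b := by
  generalize signBit a = s; generalize signBit b = t
  revert s t; decide

/-- The `I₀*` relations as the vanishing of the two affine-linear coordinates `f₁ = ρ + κα + δ₁β`,
`f₂ = σ + δ₂α + κ'β`. [folklore] -/
theorem rel_iff (ρ σ α β κ κ' δ₁ δ₂ : ZMod 2) :
    (ρ + κ * α + δ₁ * β = 0 ∧ σ + δ₂ * α + κ' * β = 0) ↔ (ρ = α * κ + β * δ₁ ∧ σ = α * δ₂ + β * κ') := by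
  revert ρ σ α β κ κ' δ₁ δ₂; decide

/-- A vector of `(ℤ/2)⁷` (or any `Fin 7 → R`) vanishes iff its seven entries do. [folklore] -/
theorem vec7_eq_zero_iff {R : Type*} [Zero R] (v : Fin 7 → R) :
    v = 0 ↔ (v 0 = 0 ∧ v 1 = 0 ∧ v 2 = 0 ∧ v 3 = 0 ∧ v 4 = 0 ∧ v 5 = 0 ∧ v 6 = 0) := by
  constructor
  · intro h; subst h; exact ⟨rfl, rfl, rfl, rfl, rfl, rfl, rfl⟩
  · rintro ⟨h0, h1, h2, h3, h4, h5, h6⟩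
    funext i
    fin_cases i
    exacts [h0, h1, h2, h3, h4, h5, h6]

end Summit.BirchSwinnertonDyer.BirchSwinnertonDyer.Theorems.GenusKolyvaginAtTwo.TorsionCellD0

end
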